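import Summits.HubbardSuperconductivity.HubbardSuperconductivity.Theorems.AnisotropyChordTransferFibre3FinMHoleL11a
import Summits.HubbardSuperconductivity.HubbardSuperconductivity.Theorems.AnisotropyChordTransferFibre3FinMHoleL11b
import Summits.HubbardSuperconductivity.HubbardSuperconductivity.Theorems.AnisotropyChordTransferFibre3FinMHoleL11c
import Summits.HubbardSuperconductivity.HubbardSuperconductivity.Theorems.AnisotropyChordTransferFibre3FinMHoleL11d

/-!
# Route `AnisotropyChord` / H0 rotor rung: ★ the regime clause `mHole ≥ 0` at `L = 11` for EVERY ground profile (FIN-class, kernel-certified)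

`mHole_nonneg_eleven`: for every `0 < Δ < 1` and every ground two-magnon profile `f` at `L = 11`, `0 ≤ mHole 11 Δ f`, i.e.
`T⁺ ≤ ε₁(1 − 5/V + 6/V²)/2` — the first half of the regime clause of the GM₃ assembly `gm3_allL` at this `L`, by the FIN
evaluator in convolution form (`…FinConvCell`, soundness `…FinMHoleConv.mHole_nonneg_of_cells3`, kernel facts `…FinMHoleL11*`).
Prover seat `hubbard-h0-rotor-p3` g4; helper for stmt-HubbardSuperconductivity-23918 (piece A of rung 19089; `--supports`, helper class).
WHAT THIS IS NOT: nothing here proves superconductivity in the Hubbard model (rotor TARGET as worded stays FALSE, g15 verdict); one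
hypothesis of ONE conditional reduction at one `L`; the three β-free cruxes and the side condition remain. Tree imports only; no sorry.
-/

set_option linter.dupNamespace false
set_option autoImplicit false

namespace Summit.HubbardSuperconductivity.HubbardSuperconductivity.Theorems.AnisotropyChord.Transfer.Fibre3

namespace FinCell

/-- the cell list at `L = 11` (14 points in units of `2^60`, from `0` to `≥ lamTop 11`) passes cellwise. [folklore] -/
theorem cellsAll_eleven : cellsAll (mholeCellOK3 11) [0, 923476162477897, 2401038022442533, 4765136998385950, 8547695359895418, 11573742049102992, 13994579400469052, 17867919162654748, 20966590972403304, 22206059696302728, 24189209654541808, 27362249587724336, 32439113480816380, 36939046499115888] = true := by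
  simp only [cellsAll, cell11_1, cell11_2, cell11_3, cell11_4, cell11_5, cell11_6, cell11_7, cell11_8, cell11_9, cell11_10, cell11_11, cell11_12, cell11_13, Bool.true_and]

/-- kernel fact: the cell list at `L = 11` is a certificate (`mholeCheck3`): head `0`, length, `lamTop 11 ≤` last point, all cells. [folklore] -/
theorem mholeCheck3_eleven : mholeCheck3 11 [0, 923476162477897, 2401038022442533, 4765136998385950, 8547695359895418, 11573742049102992, 13994579400469052, 17867919162654748, 20966590972403304, 22206059696302728, 24189209654541808, 27362249587724336, 32439113480816380, 36939046499115888] = true := by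
  unfold mholeCheck3
  rw [cellsAll_eleven]
  decide +kernel

end FinCell

/-- ★★ THE REGIME CLAUSE `mHole ≥ 0` AT `L = 11`: every ground two-magnon profile at `L = 11`, `0 < Δ < 1`, has
`T⁺ ≤ ε₁(1 − 5/V + 6/V²)/2` (FIN-class, kernel-certified with zero data). [folklore] -/
theorem mHole_nonneg_eleven {Δ : ℝ} (hΔ0 : 0 < Δ) (hΔ1 : Δ < 1) :
    ∀ lam2 : ℝ, ∀ f : Tor 11 → ℝ, IsGroundTwoMagnon 11 Δ lam2 f → 0 ≤ mHole 11 Δ f :=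
  FinCell.mHole_nonneg_of_cells3 11 (by norm_num) [0, 923476162477897, 2401038022442533, 4765136998385950, 8547695359895418, 11573742049102992, 13994579400469052, 17867919162654748, 20966590972403304, 22206059696302728, 24189209654541808, 27362249587724336, 32439113480816380, 36939046499115888] FinCell.mholeCheck3_eleven hΔ0 hΔ1

end Summit.HubbardSuperconductivity.HubbardSuperconductivity.Theorems.AnisotropyChord.Transfer.Fibre3
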